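import Summits.CriticalPhenomena.PercolationContinuityZ3.Theorems.Transplant.SkelPhiScalesCert
import HarnessLib

/-!
# D″ node, STRUCTURE-FREE layer L5′.3d (V98 p3 column; P4-GENERAL §16.2 (i), §16.6; DPRIME-SCOPE p3 addendum L.4): STEP I′ CERTIFIED AT THE
# REFERENCE DENSITY, part 2 — the assembly: seed scale `m` (uniform over the base vertices), radius shift `off = cylRadMax m m`, the per-type
# bands and their TYPE-ENVELOPES `Gb`/`Fb` (F1 ruling), the window transfer with the cylinder tail (`SkelPhiLinkedSide`), the uniqueness zone of
# the shifted fat prisms, packaged as `D : StepI.Data V` with EVERY input over `StepI.index types Sz Sx Sy` of probability `> 1 − δ` at `p`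

builds on p205010 (kernel theorem, internal audit signed; external expert review pending) — nothing in this file uses p205010.
Lane `prim-bschramm`, seat `prim-bschramm-p3` (gen 7; D″ design owner); helper file (`--supports stmt-CriticalPhenomena-4575`).
Hypotheses (all in dictionary form): `Lip`, `Steps`, `CylConn`, `Frames`, Φ2 `CylSubcritical`, the slab inputs `SlabInputs` ((F1)), `θ_z(p) > 0`, a.s.
uniqueness at `p`, `0 < p`, and the two point elements `NegAt`/`FlipAt` at every base vertex — for a `PlanarSkeletonSign` of subexponential growth
every one is a field or a landed theorem (`slab_F1_inputs`, Burton–Keane), so the instance file is plumbing.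
* §1 `of_mem_index` (case analysis of the index set), `preimage_fatSeqOff_of_neg/flip` (the shifted seed is invariant);
* §2 **`real_event_zero_ge`**, **`real_event_one_ge`** (per type and extent `ℓ ≥ ψ m + off + 1`: the link input has probability
  `≥ 1 − η^{1/8} − (1/2)^ℓ`, from `real_sideHalfHit/topHalfHit_ge_of_band` + `real_linkIn_rhalf_fat_ge`);
* §3 **`exists_stepI`** — the packaged Step I′: `∃ D off M₀ n₁`, `D = ⟨fatSeqOff off, m, fatRadius, Gb, Fb⟩`, `m₀ ≤ m`, `m ≤ Gb ℓ, Fb ℓ`, and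
  `∀ Sz ⊆ [M₀,∞), Sx Sy ⊆ [n₁,∞), ∀ i ∈ index types Sz Sx Sy, 1 − δ < P_p(event G φ D i)`.
[cite: KozmaNitzan2024, §4 p. 17 (Step I: the scales m, M), Lemma 7 (p. 15), Lemma 9 (p. 16)] [cite: GrimmettPercolation1999, §7.3 (7.41)–(7.51)]
-/

noncomputable section

open MeasureTheory

namespace Summit.CriticalPhenomena.PercolationContinuityZ3.Theorems.Transplant

namespace Skelφ

open Literature.Probability.Percolation Literature.Probability.LatticeModels SimpleGraph KNLevels
open Literature.Barriers.CriticalPhenomena (graphBall graphBall_finite mem_graphBall_self graphBall_mono)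
open scoped Classical

variable {V : Type} {G : SimpleGraph V} [G.LocallyFinite] {φ : V → Site 2} {types : Finset V}

/-! ## §1 Index bookkeeping; invariance of the shifted seed -/

omit [G.LocallyFinite] in
/-- **Case analysis of the index set**: a member is a base vertex with either a zone scale in `Sz`, or an x-extent in `Sx`, or a y-extent in `Sy`. [folklore] -/
theorem StepI.of_mem_index {Sz Sx Sy : Finset ℕ} {t : V} {s : ℕ} {og : Option (Fin 2 × ℤˣ × ℤˣ)}
    (hi : ((t, s, og) : StepI.Idx V) ∈ StepI.index types Sz Sx Sy) :
    t ∈ types ∧ (og = none → s ∈ Sz) ∧ (∀ σ τ : ℤˣ, og = some (0, σ, τ) → s ∈ Sx) ∧ (∀ σ τ : ℤˣ, og = some (1, σ, τ) → s ∈ Sy) := by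
  simp only [StepI.index, Finset.mem_product, Finset.mem_union, Finset.mem_singleton, Finset.mem_image, Finset.mem_univ, true_and] at hi
  obtain ⟨ht, h⟩ := hi
  refine ⟨ht, fun hn => ?_, fun σ τ hs => ?_, fun σ τ hs => ?_⟩
  · subst hn
    rcases h with (⟨hs, -⟩ | ⟨-, στ, hστ⟩) | ⟨-, στ, hστ⟩
    · exact hs
    · exact absurd hστ (by simp)
    · exact absurd hστ (by simp)
  · subst hs
    rcases h with (⟨-, h0⟩ | ⟨hs, -⟩) | ⟨-, στ, hστ⟩
    · exact absurd h0 (by simp)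
    · exact hs
    · simp only [Option.some.injEq, Prod.mk.injEq] at hστ
      exact absurd hστ.1 (by decide)
  · subst hs
    rcases h with (⟨-, h0⟩ | ⟨-, στ, hστ⟩) | ⟨hs, -⟩
    · exact absurd h0 (by simp)
    · simp only [Option.some.injEq, Prod.mk.injEq] at hστ
      exact absurd hστ.1 (by decide)
    · exact hs

section Assembly

variable [Countable V] (hfr : Frames G φ types) {p : unitInterval} (hC : CylSubcritical G φ types p)

/-- The shifted seed is invariant under the central inversion at `t`. [folklore] -/
theorem preimage_fatSeqOff_of_neg {ρ : G ≃g G} {t : V} (hρt : ρ t = t) (hρ : ∀ w, φ (ρ w) - φ t = -(φ w - φ t)) (off m : ℕ) :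
    ρ ⁻¹' (↑(fatSeqOff hfr hC off t m) : Set V) = ↑(fatSeqOff hfr hC off t m) :=
  preimage_cylBallFin_of_smap hρt (ε := fun _ => -1) (fun w => by rw [hρ w, neg_eq_smap]) m _

/-- The shifted seed is invariant under the flip at `t`. [folklore] -/
theorem preimage_fatSeqOff_of_flip {ρ : G ≃g G} {t : V} (hρt : ρ t = t) (hρ : ∀ w, φ (ρ w) - φ t = flipSnd (φ w - φ t)) (off m : ℕ) :
    ρ ⁻¹' (↑(fatSeqOff hfr hC off t m) : Set V) = ↑(fatSeqOff hfr hC off t m) :=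
  preimage_cylBallFin_of_smap hρt (ε := fun i => if i = 0 then 1 else -1) (fun w => by rw [hρ w, flipSnd_eq_smap]) m _

/-! ## §2 The link inputs, per type and extent -/

/-- **The x-link input at extent `ℓ`**: for a base vertex `t` with band `hb` of the shifted seed at threshold `1 − √η`, point elements at `t`, an envelope
value `Gℓ ≥ G_t(ℓ)`, and `ℓ ≥ ψ m + off + 1`: each half of the `0`-facing sides of `R(ℓ, Gℓ)` is linked from the seed inside the fat rectangle with
probability `≥ 1 − η^{1/8} − (1/2)^ℓ`. [cite: KozmaNitzan2024, §4 Lemma 9 p. 16, p. 17 (Step I)] -/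
theorem real_event_zero_ge {t : V} (ht : t ∈ types) {m off : ℕ} {η : ℝ}
    (hb : TwoAxis.IsMonotoneBand
      (fun ℓ₁ ℓ₂ => (bondPercolation G p).real (TwoAxis.TopsHit (relCoord φ t 0) (relCoord φ t 1) ↑(fatSeqOff hfr hC off t m) ℓ₁ ℓ₂))
      (fun ℓ₁ ℓ₂ => (bondPercolation G p).real (TwoAxis.SidesHit (relCoord φ t 0) (relCoord φ t 1) ↑(fatSeqOff hfr hC off t m) ℓ₁ ℓ₂))
      (1 - Real.sqrt η) m)
    (hneg : NegAt G φ t) (hflip : FlipAt G φ t) (Gb Fb : ℕ → ℕ) {ℓ : ℕ}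
    (hG : TwoAxis.bandG (fun ℓ₁ ℓ₂ => (bondPercolation G p).real
      (TwoAxis.SidesHit (relCoord φ t 0) (relCoord φ t 1) ↑(fatSeqOff hfr hC off t m) ℓ₁ ℓ₂)) (1 - Real.sqrt η) m ℓ ≤ Gb ℓ)
    (hℓ : fatRadius hfr hC m + off + 1 ≤ ℓ) (σ τ : ℤˣ) :
    1 - Real.sqrt (Real.sqrt (Real.sqrt η)) - (1 / 2 : ℝ) ^ ℓ ≤ (bondPercolation G p).real
      (linkIn (rectPrism G φ t (StepI.widths Gb Fb 0 ℓ) (fatRadius hfr hC (amax (StepI.widths Gb Fb 0 ℓ)))) (fatSeqOff hfr hC off t m)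
        (rhalf G φ t (StepI.widths Gb Fb 0 ℓ) (fatRadius hfr hC (amax (StepI.widths Gb Fb 0 ℓ))) 0 (σ : ℤ) (τ : ℤ))) := by
  set a : Fin 2 → ℕ := StepI.widths Gb Fb 0 ℓ with ha
  have ha0 : a 0 = ℓ := StepI.widths_self Gb Fb 0 ℓ
  have ha1 : a 1 = Gb ℓ := StepI.widths_zero_one Gb Fb ℓ
  have hψm := le_fatRadius hfr hC m
  have hmℓ : m ≤ ℓ := by omega
  have hℓa : ℓ ≤ amax a := by rw [← ha0]; exact le_amax a 0
  have hn : 1 ≤ amax a := by omega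
  -- the seed lies one level below the fat prism of the kit
  have hB : fatSeqOff hfr hC off t m ⊆ fatSeq hfr hC t (amax a - 1) := fatSeqOff_subset_fatSeq hfr hC off (by omega) (by omega)
  -- window transfer + tail
  have hlink := (real_linkIn_rhalf_fat_ge hfr hC ht a hn hB (σ : ℤ) (τ : ℤ)).1
  -- the half inside the infinite rectangle-cylinder
  obtain ⟨ρ, hρt, hρ⟩ := hneg
  obtain ⟨ρ₁, hρ₁t, hρ₁⟩ := hflip
  have hσ : (σ : ℤ) = 1 ∨ (σ : ℤ) = -1 := by rcases Int.units_eq_one_or σ with h | h <;> simp [h]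
  have hτ : (τ : ℤ) = 1 ∨ (τ : ℤ) = -1 := by rcases Int.units_eq_one_or τ with h | h <;> simp [h]
  have hhalf := real_sideHalfHit_ge_of_band hb hρ (preimage_fatSeqOff_of_neg hfr hC hρt hρ off m) hρ₁
    (preimage_fatSeqOff_of_flip hfr hC hρ₁t hρ₁ off m) (ℓ₁ := a 0) (ℓ₂ := a 1) (by rw [ha0]; exact hmℓ) (by rw [ha0, ha1]; exact hG) hσ hτ
  have htail : (1 / 2 : ℝ) ^ amax a ≤ (1 / 2 : ℝ) ^ ℓ := pow_le_pow_of_le_one (by norm_num) (by norm_num) hℓa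
  linarith

/-- **The y-link input at extent `ℓ`** (dually: `R(Fℓ, ℓ)`, `Fℓ ≥ F_t⁻¹(ℓ)`, the `1`-facing halves). [cite: KozmaNitzan2024, §4 Lemma 9 p. 16, p. 17 (Step I)] -/
theorem real_event_one_ge {t : V} (ht : t ∈ types) {m off : ℕ} {η : ℝ}
    (hb : TwoAxis.IsMonotoneBand
      (fun ℓ₁ ℓ₂ => (bondPercolation G p).real (TwoAxis.TopsHit (relCoord φ t 0) (relCoord φ t 1) ↑(fatSeqOff hfr hC off t m) ℓ₁ ℓ₂))
      (fun ℓ₁ ℓ₂ => (bondPercolation G p).real (TwoAxis.SidesHit (relCoord φ t 0) (relCoord φ t 1) ↑(fatSeqOff hfr hC off t m) ℓ₁ ℓ₂))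
      (1 - Real.sqrt η) m)
    (hneg : NegAt G φ t) (hflip : FlipAt G φ t) (Gb Fb : ℕ → ℕ) {ℓ : ℕ}
    (hF : TwoAxis.bandFinv (fun ℓ₁ ℓ₂ => (bondPercolation G p).real
      (TwoAxis.TopsHit (relCoord φ t 0) (relCoord φ t 1) ↑(fatSeqOff hfr hC off t m) ℓ₁ ℓ₂)) (1 - Real.sqrt η) m ℓ ≤ Fb ℓ)
    (hℓ : fatRadius hfr hC m + off + 1 ≤ ℓ) (σ τ : ℤˣ) :
    1 - Real.sqrt (Real.sqrt (Real.sqrt η)) - (1 / 2 : ℝ) ^ ℓ ≤ (bondPercolation G p).real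
      (linkIn (rectPrism G φ t (StepI.widths Gb Fb 1 ℓ) (fatRadius hfr hC (amax (StepI.widths Gb Fb 1 ℓ)))) (fatSeqOff hfr hC off t m)
        (rhalf G φ t (StepI.widths Gb Fb 1 ℓ) (fatRadius hfr hC (amax (StepI.widths Gb Fb 1 ℓ))) 1 (σ : ℤ) (τ : ℤ))) := by
  set a : Fin 2 → ℕ := StepI.widths Gb Fb 1 ℓ with ha
  have ha0 : a 0 = Fb ℓ := StepI.widths_one_zero Gb Fb ℓ
  have ha1 : a 1 = ℓ := StepI.widths_self Gb Fb 1 ℓ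
  have hψm := le_fatRadius hfr hC m
  have hmℓ : m ≤ ℓ := by omega
  have hℓa : ℓ ≤ amax a := by rw [← ha1]; exact le_amax a 1
  have hn : 1 ≤ amax a := by omega
  have hB : fatSeqOff hfr hC off t m ⊆ fatSeq hfr hC t (amax a - 1) := fatSeqOff_subset_fatSeq hfr hC off (by omega) (by omega)
  have hlink := (real_linkIn_rhalf_fat_ge hfr hC ht a hn hB (σ : ℤ) (τ : ℤ)).2
  obtain ⟨ρ, hρt, hρ⟩ := hneg
  obtain ⟨ρ₁, hρ₁t, hρ₁⟩ := hflip
  have hσ : (σ : ℤ) = 1 ∨ (σ : ℤ) = -1 := by rcases Int.units_eq_one_or σ with h | h <;> simp [h]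
  have hτ : (τ : ℤ) = 1 ∨ (τ : ℤ) = -1 := by rcases Int.units_eq_one_or τ with h | h <;> simp [h]
  have hhalf := real_topHalfHit_ge_of_band hb hρ (preimage_fatSeqOff_of_neg hfr hC hρt hρ off m) hρ₁
    (preimage_fatSeqOff_of_flip hfr hC hρ₁t hρ₁ off m) (ℓ₁ := a 0) (ℓ₂ := a 1) (by rw [ha1]; exact hmℓ) (by rw [ha0, ha1]; exact hF) hσ hτ
  have htail : (1 / 2 : ℝ) ^ amax a ≤ (1 / 2 : ℝ) ^ ℓ := pow_le_pow_of_le_one (by norm_num) (by norm_num) hℓa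
  linarith

/-! ## §3 Step I′ packaged -/

/-- Elementary: `√√√((x²)²)² = x` for `x ≥ 0`. [folklore] -/
theorem sqrt_sqrt_sqrt_pow8 {x : ℝ} (hx : 0 ≤ x) : Real.sqrt (Real.sqrt (Real.sqrt (((x ^ 2) ^ 2) ^ 2))) = x := by
  rw [Real.sqrt_sq (by positivity), Real.sqrt_sq (by positivity), Real.sqrt_sq hx]

/-- **STEP I′ OF ROUTE D″ v2 AT THE REFERENCE DENSITY** (P4-GENERAL §16.2 (i)/§16.6, in the vocabulary of `SkelPhiInputs`): from `θ_z(p) > 0`, a.s.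
uniqueness, Φ2, the slab inputs, and the two sign changes at every base vertex, for every `δ > 0` and `m₀` there are Step-I′ data
`D = ⟨fatSeqOff off, m, fatRadius, Gb, Fb⟩` (`m ≥ m₀`, `m ≥ 1`, `Gb, Fb ≥ m`) and thresholds `M₀, n₁ > m` such that EVERY input over
`StepI.index types Sz Sx Sy` with `Sz ⊆ [M₀, ∞)`, `Sx, Sy ⊆ [n₁, ∞)` has probability `> 1 − δ` at `p`. [cite: KozmaNitzan2024, §4 p. 17 (Step I)] -/
theorem exists_stepI [DecidableEq V] (hlip : Lip G φ) (hstep : Steps G φ) (hκ : CylConn G φ types) (hp0 : 0 < (p : ℝ))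
    (hsl : SlabInputs G φ types p) {z : V} (hθ : 0 < theta G z p) (hU : ∀ᵐ ω ∂(bondPercolation G p), numInfiniteClusters ω ≤ 1)
    (hneg : ∀ t ∈ types, NegAt G φ t) (hflip : ∀ t ∈ types, FlipAt G φ t) {δ : ℝ} (hδ : 0 < δ) (m₀ : ℕ) :
    ∃ (D : StepI.Data V) (off M₀ n₁ : ℕ), m₀ ≤ D.k ∧ 1 ≤ D.k ∧ D.R = fatRadius hfr hC ∧ D.Λ = fatSeqOff hfr hC off ∧ D.k < M₀ ∧ D.k < n₁ ∧
      (∀ ℓ, D.k ≤ D.Gb ℓ ∧ D.k ≤ D.Fb ℓ) ∧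
      ∀ Sz Sx Sy : Finset ℕ, (∀ M ∈ Sz, M₀ ≤ M) → (∀ ℓ ∈ Sx, n₁ ≤ ℓ) → (∀ ℓ ∈ Sy, n₁ ≤ ℓ) →
        ∀ i ∈ StepI.index types Sz Sx Sy, 1 - δ < (bondPercolation G p).real (StepI.event G φ D i) := by
  set μ := bondPercolation G p with hμ
  -- the tolerances
  set δ' : ℝ := min δ 1 with hδ'
  have hδ'0 : 0 < δ' := lt_min hδ one_pos
  have hδ'δ : δ' ≤ δ := min_le_left _ _
  have hδ'1 : δ' ≤ 1 := min_le_right _ _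
  set x : ℝ := δ' / 2 with hx
  have hx0 : 0 < x := by positivity
  set η : ℝ := ((x ^ 2) ^ 2) ^ 2 with hη
  have hη0 : 0 < η := by positivity
  have hx1 : x ≤ 1 := by rw [hx]; linarith
  have hη1 : η ≤ 1 := by
    have h2 : x ^ 2 ≤ 1 := pow_le_one₀ hx0.le hx1
    have h4 : (x ^ 2) ^ 2 ≤ 1 := pow_le_one₀ (by positivity) h2
    exact pow_le_one₀ (by positivity) h4
  have h8 : Real.sqrt (Real.sqrt (Real.sqrt η)) = x := sqrt_sqrt_sqrt_pow8 hx0.le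
  obtain ⟨N, hN⟩ := exists_pow_lt_of_lt_one hx0 (show (1 / 2 : ℝ) < 1 by norm_num)
  -- the seed scale, uniform over the base vertices and the shifts
  obtain ⟨m, hm₀, hseed⟩ := exists_seed_scale hfr hC hκ hθ hη0 (max m₀ 1)
  have hm0 : m₀ ≤ m := le_trans (le_max_left _ _) hm₀
  have hm1 : 1 ≤ m := le_trans (le_max_right _ _) hm₀
  -- the radius shift
  set off : ℕ := cylRadMax G φ types m m with hoff
  have hoff' : ∀ t ∈ types, cylRad G φ t m m ≤ fatRadius hfr hC m + off := fun t ht =>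
    (cylRad_le_cylRadMax G φ ht m m).trans (Nat.le_add_left _ _)
  -- the per-type bands and the envelopes
  have hb : ∀ t ∈ types, TwoAxis.IsMonotoneBand
      (fun ℓ₁ ℓ₂ => μ.real (TwoAxis.TopsHit (relCoord φ t 0) (relCoord φ t 1) ↑(fatSeqOff hfr hC off t m) ℓ₁ ℓ₂))
      (fun ℓ₁ ℓ₂ => μ.real (TwoAxis.SidesHit (relCoord φ t 0) (relCoord φ t 1) ↑(fatSeqOff hfr hC off t m) ℓ₁ ℓ₂)) (1 - Real.sqrt η) m :=
    fun t ht => isMonotoneBand_at hlip hstep hκ hfr hp0 hC hsl ht hm1 (hoff' t ht) hη1 (hseed t ht off)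
  set Gb : ℕ → ℕ := fun ℓ => max m (types.sup fun t => TwoAxis.bandG
    (fun ℓ₁ ℓ₂ => μ.real (TwoAxis.SidesHit (relCoord φ t 0) (relCoord φ t 1) ↑(fatSeqOff hfr hC off t m) ℓ₁ ℓ₂)) (1 - Real.sqrt η) m ℓ) with hGb
  set Fb : ℕ → ℕ := fun ℓ => max m (types.sup fun t => TwoAxis.bandFinv
    (fun ℓ₁ ℓ₂ => μ.real (TwoAxis.TopsHit (relCoord φ t 0) (relCoord φ t 1) ↑(fatSeqOff hfr hC off t m) ℓ₁ ℓ₂)) (1 - Real.sqrt η) m ℓ) with hFb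
  have hGb' : ∀ t ∈ types, ∀ ℓ, TwoAxis.bandG
      (fun ℓ₁ ℓ₂ => μ.real (TwoAxis.SidesHit (relCoord φ t 0) (relCoord φ t 1) ↑(fatSeqOff hfr hC off t m) ℓ₁ ℓ₂)) (1 - Real.sqrt η) m ℓ ≤ Gb ℓ :=
    fun t ht ℓ => le_max_of_le_right (Finset.le_sup (f := fun t => TwoAxis.bandG
      (fun ℓ₁ ℓ₂ => μ.real (TwoAxis.SidesHit (relCoord φ t 0) (relCoord φ t 1) ↑(fatSeqOff hfr hC off t m) ℓ₁ ℓ₂)) (1 - Real.sqrt η) m ℓ) ht)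
  have hFb' : ∀ t ∈ types, ∀ ℓ, TwoAxis.bandFinv
      (fun ℓ₁ ℓ₂ => μ.real (TwoAxis.TopsHit (relCoord φ t 0) (relCoord φ t 1) ↑(fatSeqOff hfr hC off t m) ℓ₁ ℓ₂)) (1 - Real.sqrt η) m ℓ ≤ Fb ℓ :=
    fun t ht ℓ => le_max_of_le_right (Finset.le_sup (f := fun t => TwoAxis.bandFinv
      (fun ℓ₁ ℓ₂ => μ.real (TwoAxis.TopsHit (relCoord φ t 0) (relCoord φ t 1) ↑(fatSeqOff hfr hC off t m) ℓ₁ ℓ₂)) (1 - Real.sqrt η) m ℓ) ht)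
  -- the uniqueness zone of the shifted fat prisms at every base vertex
  have hzone : ∀ t ∈ types, ∃ n₀ : ℕ, ∀ n, n₀ ≤ n → 1 - δ' < μ.real (UniqZone.zone G (fatSeqOff hfr hC off t) m n) :=
    fun t ht => UniqZone.exists_forall_le_lt_real_zone p hU (fatSeqOff_nest hfr hC off hlip t)
      (fatSeqOff_monotone hfr hC off t) (fatSeqOff_exhaust hfr hC off hκ ht) m hδ'0
  choose! n₀ hn₀ using hzone
  -- the thresholds and the data
  set M₀ : ℕ := types.sup n₀ + m + 1 with hM₀
  set n₁ : ℕ := fatRadius hfr hC m + off + N + 1 with hn₁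
  have hkM : m < M₀ := by rw [hM₀]; omega
  have hkn : m < n₁ := by rw [hn₁]; have := le_fatRadius hfr hC m; omega
  refine ⟨⟨fatSeqOff hfr hC off, m, fatRadius hfr hC, Gb, Fb⟩, off, M₀, n₁, hm0, hm1, rfl, rfl, hkM, hkn,
    fun ℓ => ⟨le_max_left _ _, le_max_left _ _⟩, ?_⟩
  intro Sz Sx Sy hSz hSx hSy i hi
  obtain ⟨t, s, og⟩ := i
  obtain ⟨ht, hz, h0, h1⟩ := StepI.of_mem_index hi
  -- the common bound for a link input at an extent `ℓ ≥ n₁`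
  have htail : ∀ ℓ, n₁ ≤ ℓ → (1 / 2 : ℝ) ^ ℓ < x := fun ℓ hℓ =>
    lt_of_le_of_lt (pow_le_pow_of_le_one (by norm_num) (by norm_num) (by omega)) hN
  rcases og with _ | ⟨ax, σ, τ⟩
  · -- the zone
    have hs := hSz s (hz rfl)
    have h := hn₀ t ht s (by have := Finset.le_sup (f := n₀) ht; omega)
    rw [StepI.event_none]
    exact lt_of_le_of_lt (by linarith) h
  · rw [StepI.event_some]
    fin_cases ax
    · -- x-links
      have hs := hSx s (h0 σ τ rfl)
      have hb0 := real_event_zero_ge hfr hC ht (hb t ht) (hneg t ht) (hflip t ht) Gb Fb (hGb' t ht s) (by omega) σ τ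
      rw [h8] at hb0
      have := htail s hs
      exact lt_of_lt_of_le (by linarith) hb0
    · -- y-links
      have hs := hSy s (h1 σ τ rfl)
      have hb1 := real_event_one_ge hfr hC ht (hb t ht) (hneg t ht) (hflip t ht) Gb Fb (hFb' t ht s) (by omega) σ τ
      rw [h8] at hb1
      have := htail s hs
      exact lt_of_lt_of_le (by linarith) hb1

end Assembly

end Skelφ

end Summit.CriticalPhenomena.PercolationContinuityZ3.Theorems.Transplant

end
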